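import Literature.MathematicalPhysics.QuantumFieldTheory.Balaban1983to89.B9Thm31GpAgmonDecayNearFlatTowerZd
import Literature.MathematicalPhysics.QuantumFieldTheory.Balaban1983to89.B9Thm31NearFlatTransportersZd

/-!
# `Balaban1983to89.B9Thm31GpAgmonDecayNearFlatClassZd` — [Balaban1985BackgroundPropagators] Thm 3.1 (3.42) p. 397 «uniformly in U, Ω_j» ON THE SMALL-PLAQUETTE CLASS:
# ★★★ at EVERY cube member of [Balaban1985RegularSpaces] (1.131) and EVERY unitary background `U₀` with `pdev U₀ < α₀L^{−2k}` and `‖U₀(b) − 1‖ ≤ θ′η` on all bonds (the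
# class [Balaban1985Averaging] (52) + the gauge-fixed smallness of [B9] (3.35)∕p. 416), for print-scaled weights `a_lo(Lᵈ)ʲ(ηLʲ)⁻² ≤ a_j ≤ a_hi(Lᵈ)ʲ(ηLʲ)⁻²`, `m₈ = min{8, a_lo}`,
# `ηLᵐ ≤ 1`, `L^{−k} ≤ η`, fibre-norm comparison `C_u, C_l`, and the CLASS smallness `4(2C_uC_l)²(dθ′² + a_hi d²L²(256(d+1)(d+4)α₀ + θ′)²) ≤ m₈`: for every `0 ≤ κ ≤ 1` with
# `κ(48d + 120a_hi) ≤ m₈` and all `x, y ∈ □₀`, `|(G′(U₀)δ_y w)(x)|_τ ≤ (8∕m₈)·(ηLᵐ)²·e^{−κL^{−m}|x−y|_∞}·|w|_τ` — constants in `d, L, a_lo, a_hi, C_u, C_l, α₀, θ′` ONLY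

statement-level skeleton of published theorems with citation tags; proofs where landed; nothing here is a claim about the
Yang–Mills mass gap

`[Balaban1985BackgroundPropagators]` ("B9", CMP **99** (1985) 389–434) Thm 3.1 p. 397 (*«uniformly in U, Ω_j»* for `U` in (3.35)); Thm 3.11 p. 416 (*«U = e^{iηA} with A small»*);
`[Balaban1985Averaging]` Prop. 2 (52)–(54) p. 26, (42)–(43) pp. 23–24, (122)–(126) p. 36 (the averaged backgrounds of a small-plaquette configuration stay unitary and close to `1`).
THIS FILE is the class-level end of this seat's Agmon road: dag-n06-w4 g5's `B9Thm31NearFlatTransportersZd` reads the tower-pair transporter closeness `ε′_i` and the weight bound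
`κ′_T = a_hi d²L²(256(d+1)(d+4)α₀ + θ′)²` OFF THE BACKGROUND'S OWN SMALLNESS (`bgT_mem_unitaryUnits_of_pdev ∕ norm_bgT_pair_sub_one_le ∕ sum_eps_sq_weight_le`), and FILE 11's
`fnorm_GpZd_single_le_exp_nearFlat_cubeMember_of_norm` consumes them — so NO transporter hypothesis is left: the near-flat member-uniform decay of `G′(U₀)` holds on the CLASS.

CITATION HEADER (lean-in-tree rule).  Cell `pub-ymgap` (YM Track A, HUMAN RULING D-0062 ∕ D-0149 width push), DAG node N06 = [B9], width seat
`pub-ymgap-dag-n06-w2` (g5), CLAIM-12.  Inputs BY NAME: FILE 11's `fnorm_GpZd_single_le_exp_nearFlat_cubeMember_of_norm` (this seat), dag-n06-w4 g5's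
`bgT_mem_unitaryUnits_of_pdev ∕ norm_bgT_pair_sub_one_le ∕ sum_eps_sq_weight_le` (`B9Thm31NearFlatTransportersZd`).  Nothing restated.

WHAT IS PROVED (kernel, 0 sorry, 0 def; no `instance`, no `notation`).
* ★★★ `fnorm_GpZd_single_le_exp_nearFlat_cubeMember_of_class` — the statement of the title.

HONEST SCOPE.  (i) The class is displayed by `pdev U₀ < α₀(L^{−k})²`, `C0 d α₀ ≤ 1∕3`, `2α₀ ≤ c2′ d L`, and the BOND smallness `‖U₀(b) − 1‖ ≤ θ′η` (print's gauge-fixed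
`U = e^{iηA}`, `A` small — the axial gauge producing it from (3.35) is NOT here); the two-sided weight scaling is a hypothesis on the member's data (print's `a_j` satisfy it);
(ii) single coarsest-scale rate, `L²`-derived pointwise bound; NOT print's multi-scale `d(y,y′)`, NOT the sup∕Hölder entries, NOT Thm 3.2∕3.3.  Count-neutral; N05 ∕ N06 NOT
discharged; K1⁹ `stmt-QuantumFields-27364` NOT closed; one finite `𝕋⁴` programme at fixed `ε`, Bałaban as printed; R4 closes only the conditional finite-`𝕋⁴` rung
`BalabanLadder.UV` — nothing continuum ∕ ℝ⁴ ∕ OS ∕ mass gap ∕ Clay.  Unit `pub-ymgap-dag-n06-w2` (g5), 2026-08-28.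
-/

noncomputable section

open scoped BigOperators

namespace Literature.MathematicalPhysics.QuantumFieldTheory.Balaban1983to89.B9Thm31GpAgmonDecayNearFlatClassZd

open Literature.MathematicalPhysics.QuantumLattice (blockMap)
open B7Prop1Explicit (e)
open B7Prop2Explicit (unitaryUnits pdev C0 c2')
open B8Eq119TwistedAxial (bgT)
open B8Eq131CubesAdmissible (cubeFam)
open B8LeafModelZd (ZdIdx)
open B8Eq191FlatLettersCubeMember (cubeLamS_finite)
open B9Thm311PosDefOpenZd (cubeMember_Ω0_finite)
open B9Eq321LandauProjectionZd (suppSub formE)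
open B9Eq324DeltaPrimeAZd (single restrictSite deltaPrimeADom GpZd)
open B9Eq342CombesThomasFormZd
open B9Thm31GpAgmonDecayNearFlatTowerZd (fnorm_GpZd_single_le_exp_nearFlat_cubeMember_of_norm)
open B9Thm31NearFlatTransportersZd (bgT_mem_unitaryUnits_of_pdev norm_bgT_pair_sub_one_le sum_eps_sq_weight_le)
open LatticeNorms (linfDist)

export B7Prop1Explicit (Site)

variable {d : ℕ} {𝔸 : Type*} [CStarAlgebra 𝔸]

variable (L : ℕ) (τ : 𝔸 →ₗ[ℂ] ℂ) [FiniteDimensional ℝ 𝔸] (hτp : ∀ a : 𝔸, a ≠ 0 → 0 < (τ (star a * a)).re)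

/-- ★★★ **[B9] THM 3.1's (3.42), n = 0 SHAPE, FOR `G′(U₀)` AT EVERY CUBE MEMBER AND EVERY BACKGROUND OF THE SMALL-PLAQUETTE CLASS — MEMBER-UNIFORM EXPLICIT CONSTANTS.**
`2 ≤ L ≤ ρ`, `m ≤ k = i.k`, `ηLᵐ ≤ 1`, `L^{−k} ≤ η`; `τ` tracial Hermitian faithful, `𝔸` finite-dimensional nontrivial with `|a|_τ ≤ C_u‖a‖`, `‖a‖ ≤ C_l|a|_τ`; print-scaled weights
`a_lo(Lᵈ)ʲ(ηLʲ)⁻² ≤ a_j ≤ a_hi(Lᵈ)ʲ(ηLʲ)⁻²` (`j ≤ m`, `0 < a_lo`), `m₈ = min{8, a_lo}`; a unitary `U₀` with `pdev U₀ < α₀(L^{−k})²` (`0 < α₀`, `C0 d α₀ ≤ 1∕3`, `2α₀ ≤ c2′ d L`) and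
`‖U₀(x,μ) − 1‖ ≤ θ′η` (`θ′ ≥ 0`); CLASS smallness `4(2C_uC_l)²(dθ′² + a_hi d²L²(256(d+1)(d+4)α₀ + θ′)²) ≤ m₈`; `0 ≤ κ ≤ 1` with `κ(48d + 120a_hi) ≤ m₈`.  THEN for all `x, y ∈ □₀`:
`|(G′(U₀)δ_y w)(x)|_τ ≤ (8∕m₈)·(ηLᵐ)²·e^{−κL^{−m}|x−y|_∞}·|w|_τ`.
[cite: Balaban1985BackgroundPropagators, Thm 3.1 p.397, (3.42) p.397, Thm 3.11 p.416, (3.24) p.394; Balaban1985Averaging, Prop. 2 p.26, (122)–(126) p.36; Balaban1985RegularSpaces, (1.131) p.99; Agmon1982, Thm 1.5 p.19] -/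
theorem fnorm_GpZd_single_le_exp_nearFlat_cubeMember_of_class [Nontrivial 𝔸] (hd : 0 < d) (hL : 2 ≤ L) (hτt : ∀ a b : 𝔸, τ (a * b) = τ (b * a))
    (hτs : ∀ a : 𝔸, τ (star a) = starRingEnd ℂ (τ a)) {Cu Cl : ℝ} (hCu : ∀ a : 𝔸, fnorm τ a ≤ Cu * ‖a‖) (hCl : ∀ a : 𝔸, ‖a‖ ≤ Cl * fnorm τ a)
    (hCu0 : 0 ≤ Cu) (hCl0 : 0 ≤ Cl) (i : ZdIdx d L) {ac : Site d} {Mc ρc : ℕ} (hΩ : i.Ω = cubeFam false L ac Mc ρc i.k)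
    (hρc : L ≤ ρc) {m : ℕ} (hm : m ≤ i.k) (hηm : i.η * (L : ℝ) ^ m ≤ 1) (hkη : ((L : ℝ) ^ i.k)⁻¹ ≤ i.η)
    {a : ℕ → ℝ} (ha : ∀ j, 0 ≤ a j) {a_lo a_hi : ℝ} (halo : 0 < a_lo)
    (hlo : ∀ j ∈ Finset.range (m + 1), a_lo * ((L : ℝ) ^ d) ^ j * ((i.η * (L : ℝ) ^ j) ^ 2)⁻¹ ≤ a j)
    (hhi : ∀ j ∈ Finset.range (m + 1), a j ≤ a_hi * ((L : ℝ) ^ d) ^ j * ((i.η * (L : ℝ) ^ j) ^ 2)⁻¹)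
    {U₀ : Site d → Fin d → 𝔸ˣ} (hU : ∀ (x : Site d) (κ' : Fin d), U₀ x κ' ∈ unitaryUnits 𝔸)
    {α₀ : ℝ} (hα : 0 < α₀) (hα3 : C0 d * α₀ ≤ 1 / 3) (hα2 : 2 * α₀ ≤ c2' d L) (h52 : pdev U₀ < α₀ * (((L : ℝ) ^ i.k)⁻¹) ^ 2)
    {θ' : ℝ} (hθ' : 0 ≤ θ') (hR : ∀ (x : Site d) (μ : Fin d), ‖((U₀ x μ : 𝔸ˣ) : 𝔸) - 1‖ ≤ θ' * i.η)
    (hsmall : 4 * ((2 * Cu * Cl) ^ 2 * (d * θ' ^ 2 + a_hi * d ^ 2 * (L : ℝ) ^ 2 * (256 * (d + 1) * (d + 4) * α₀ + θ') ^ 2)) ≤ min 8 a_lo)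
    {κ : ℝ} (hκ0 : 0 ≤ κ) (hκ1 : κ ≤ 1) (hκ : κ * (48 * d + 120 * a_hi) ≤ min 8 a_lo)
    {x y : Site d} (hx : x ∈ (cubeMember_Ω0_finite i hΩ).toFinset) (hy : y ∈ (cubeMember_Ω0_finite i hΩ).toFinset) (w : 𝔸) :
    fnorm τ ((GpZd L U₀ i.η τ hτp m a (fun j => (cubeLamS_finite L ac Mc ρc i.k m j).toFinset)
        (cubeMember_Ω0_finite i hΩ).toFinset hd i.hη.ne' hτt hτs hU ha
        (restrictSite (cubeMember_Ω0_finite i hΩ).toFinset (single y w)) : Site d → 𝔸) x) ≤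
      8 / min 8 a_lo * (i.η * (L : ℝ) ^ m) ^ 2 * Real.exp (-(κ * (((L : ℝ) ^ m)⁻¹ * ((linfDist x y : ℕ) : ℝ)))) * fnorm τ w := by
  have hL1 : 1 ≤ L := le_trans one_le_two hL
  have hL0 : (0 : ℝ) < L := by exact_mod_cast (lt_of_lt_of_le zero_lt_two hL)
  have hη0 : 0 < i.η := i.hη
  -- the transporters of the class: unitary and close to `1` on the tower pairs (dag-n06-w4 g5)
  have hT : ∀ i', i' < m → ∀ z y' : Site d, bgT L U₀ i' z y' ∈ unitaryUnits 𝔸 := fun i' hi' z y' =>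
    bgT_mem_unitaryUnits_of_pdev hL i.k hU hα hα3 hα2 h52 (by omega) z y'
  set ε' : ℕ → ℝ := fun i' => d * L * (256 * (d + 1) * (d + 4) * α₀ * ((L : ℝ) ^ i' * ((L : ℝ) ^ i.k)⁻¹) ^ 2 + (L : ℝ) ^ i' * (θ' * i.η)) with hε'
  have hε'0 : ∀ i', 0 ≤ ε' i' := fun i' => by positivity
  have hδ0 : 0 ≤ θ' * i.η := by positivity
  have hTε : ∀ i', i' < m → ∀ (w' : Site d), ‖((bgT L U₀ i' (blockMap L w') w' : 𝔸ˣ) : 𝔸) - 1‖ ≤ ε' i' := fun i' hi' w' =>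
    norm_bgT_pair_sub_one_le hL i.k hU hα hα3 hα2 h52 hδ0 hR (by omega) w'
  -- the scale-free weight bound `κ′_T`
  have hηL : ∀ j ∈ Finset.range (m + 1), i.η * (L : ℝ) ^ j ≤ 1 := by
    intro j hj
    have hjm : j ≤ m := Nat.lt_succ_iff.1 (Finset.mem_range.1 hj)
    have hLj : (L : ℝ) ^ j ≤ (L : ℝ) ^ m := pow_le_pow_right₀ (by exact_mod_cast hL1) hjm
    calc i.η * (L : ℝ) ^ j ≤ i.η * (L : ℝ) ^ m := mul_le_mul_of_nonneg_left hLj hη0.le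
      _ ≤ 1 := hηm
  have haA : ∀ j ∈ Finset.range (m + 1), a j * i.η ^ 2 * ((L : ℝ) ^ j) ^ 2 ≤ a_hi * ((L : ℝ) ^ j) ^ d := by
    intro j hj
    have h := hhi j hj
    have hpos : 0 < (i.η * (L : ℝ) ^ j) ^ 2 := by positivity
    have hpow : ((L : ℝ) ^ d) ^ j = ((L : ℝ) ^ j) ^ d := by rw [← pow_mul, ← pow_mul, mul_comm]
    calc a j * i.η ^ 2 * ((L : ℝ) ^ j) ^ 2 = a j * (i.η * (L : ℝ) ^ j) ^ 2 := by ring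
      _ ≤ a_hi * ((L : ℝ) ^ d) ^ j * ((i.η * (L : ℝ) ^ j) ^ 2)⁻¹ * (i.η * (L : ℝ) ^ j) ^ 2 := mul_le_mul_of_nonneg_right h hpos.le
      _ = a_hi * ((L : ℝ) ^ j) ^ d := by rw [mul_assoc, inv_mul_cancel₀ hpos.ne', mul_one, hpow]
  have hκT : ∀ j ∈ Finset.range (m + 1), a j * ((((L : ℝ) ^ d) ^ j)⁻¹ * (∑ i' ∈ Finset.range j, ε' i') ^ 2) ≤
      a_hi * d ^ 2 * (L : ℝ) ^ 2 * (256 * (d + 1) * (d + 4) * α₀ + θ') ^ 2 := fun j hj =>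
    sum_eps_sq_weight_le hL hη0 hkη hηL hθ' hα.le ha haA hj
  have hκT0 : 0 ≤ a_hi * d ^ 2 * (L : ℝ) ^ 2 * (256 * (d + 1) * (d + 4) * α₀ + θ') ^ 2 := by
    have hahi0 : 0 ≤ a_hi := by
      have h0 := hlo 0 (Finset.mem_range.2 (Nat.succ_pos m))
      have h1 := hhi 0 (Finset.mem_range.2 (Nat.succ_pos m))
      have hpos : 0 < ((L : ℝ) ^ d) ^ 0 * ((i.η * (L : ℝ) ^ 0) ^ 2)⁻¹ := by positivity
      have : a_lo * ((L : ℝ) ^ d) ^ 0 * ((i.η * (L : ℝ) ^ 0) ^ 2)⁻¹ ≤ a_hi * ((L : ℝ) ^ d) ^ 0 * ((i.η * (L : ℝ) ^ 0) ^ 2)⁻¹ := h0.trans h1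
      rw [mul_assoc, mul_assoc] at this
      nlinarith [le_of_mul_le_mul_right this hpos]
    positivity
  exact fnorm_GpZd_single_le_exp_nearFlat_cubeMember_of_norm L τ hτp hd hL hτt hτs hCu hCl hCu0 hCl0 i hΩ hρc hm hηm ha halo hlo hhi hU hR
    hε'0 hT hTε hκT0 hκT hsmall hκ0 hκ1 hκ hx hy w

end Literature.MathematicalPhysics.QuantumFieldTheory.Balaban1983to89.B9Thm31GpAgmonDecayNearFlatClassZd

end
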